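import Summits.QuantumFields.GaugeBoot.TiltedBoxRedSiteRPNegativeUniform
import Summits.QuantumFields.GaugeBoot.TiltedBoxRedLinkRPNegativeUniform
import HarnessLib

/-!
# The reduced-half in-plane mirrors of the square tilted boxes: the uniform small-coupling window, concrete and in summary (gauge-boot, L3 supplement)

HONEST FRAMING (cell `pub-gaugeboot`, page 1 of every file): the venture produces certified bounds
on lattice expectations at stated coupling, gauge group, dimension and torus size; NOT a mass gap,
NOT a continuum limit, NOT a string tension; NOT Yang–Mills-summit-bearing (barriers
`FixedCouplingUltralocality`, `PerturbativeInvisibility`). This module collects corollaries of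
`TiltedBoxRedSiteRPNegativeUniform` / `TiltedBoxRedLinkRPNegativeUniform` for citation; no
expectation of the venture's tables is bounded here.

## Content

The in-plane mirror table of `TiltedBoxInPlaneMirrorClassification` (rows `inPlaneMirrors_reducedSite_suN`,
`inPlaneMirrors_reducedLink_suN`, gen 51) recorded for the two REDUCED-half classes — the site
mirror of the even box `ℤ^d/Γ(2P, 2P, L)` with its twisted layer left free (`RedSite.RedSiteRP`) and
the link mirror of the odd box `ℤ^d/Γ(2P+1, 2P+1, L)` likewise (`RedLink.RedLinkRP`) — that for
`SU(N)` they HOLD in `d = 2` at every real `β` and FAIL with a transverse axis (`d ≥ 3`) for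
`0 < β ≤ β₀`, where `β₀` depended on the box. With the volume-independent resummation of this
supplement the window is ONE `β₀(d, N)` for all boxes:

* **`RedSite.not_redSiteRP_uniform_suN`** / **`_uN`**, **`RedLink.not_redLinkRP_uniform_suN`** /
  **`_uN`** — `SU(N)` (`N ≥ 2`) and `U(N)` (`N ≥ 1`) on the three-dimensional boxes
  `ℤ³/Γ(2P, 2P, L)`, `ℤ³/Γ(2P+1, 2P+1, L)` (tilted plane `(0, 1)`): one `β₀ = β₀(N) > 0` for EVERY
  `P ≥ 2`, `L ≥ 2`;
* **`RedSite.not_eventually_redSiteRP_suN`** / **`_uN`**, **`RedLink.not_eventually_redLinkRP_suN`** /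
  **`_uN`** — hence at each fixed `0 < β ≤ β₀` reduced-half RP is not EVENTUALLY available along the
  boxes (for no thresholds `P₀, L₀`): the finite-volume route by which the in-plane axis mirrors
  pass to the tilted LIMIT points in `d = 2` (`TiltedBoxLimitClassBTwoDimAll`, gen 50) is closed in
  `d = 3` at small coupling. The limit statement itself (in-plane site/link RP of the tilted limit
  points in `d ≥ 3`) is NOT decided here; under DLR uniqueness it holds (`TiltedBoxLimitDLR`);
* **`inPlaneMirrors_reduced_uniform_suN`** — the summary row for `SU(N)`, `N ≥ 2`, in every `d`:
  in `d = 2` both reduced classes hold on every box (`P ≥ 2`) at every real `β`; with a transverse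
  axis `k ∉ {i, j}` ONE `β₀ > 0` refutes both on every box `P ≥ 2`, `L ≥ 2` for all `0 < β ≤ β₀`.

Small structural negatives; `β₀` explicit (`min (1/(144 d² N)) (c₁⁹/(2⁹ N¹⁰)) (c₁⁹/(3960·144⁹ d¹⁸ N¹⁰))`
with the group's (R1) constant `c₁`), absurdly small, not optimised; nothing at moderate `β`.
Mechanism folklore (Osterwalder–Seiler 1978 §3; Friedli–Velenik 2017 §5.2; M. Creutz 1983 Ch. 8–10);
statements new as theorems.
-/

noncomputable section

open MeasureTheory
open scoped ComplexConjugate ComplexOrder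
open Literature.MathematicalPhysics.QuantumFieldTheory (IsSpecialUnitaryModel IsUnitaryModel)

namespace Summit.QuantumFields.GaugeBoot

namespace TiltedRP

namespace RedSite

/-! ## Concrete: `SU(N)` and `U(N)` on the three-dimensional boxes; no eventual transfer -/

section Concrete

open Literature.MathematicalPhysics.QuantumLattice

variable {N : ℕ}

/-- ★★★ **`SU(N)` lattice Yang–Mills (`N ≥ 2`) on the even square tilted boxes `ℤ³/Γ(2P, 2P, L)`
(tilted plane `(0, 1)`): ONE `β₀ = β₀(N) > 0` such that reduced-half site RP along the axis `0`
fails on EVERY box `P ≥ 2`, `L ≥ 2` for all `0 < β ≤ β₀`** — although it holds at every `β` in two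
dimensions. [folklore] -/
theorem not_redSiteRP_uniform_suN (hN : 2 ≤ N) :
    ∃ β₀ : ℝ, 0 < β₀ ∧ ∀ (P L : ℕ) [NeZero P] [NeZero L], 2 ≤ P → 2 ≤ L →
      ∀ β : ℝ, 0 < β → β ≤ β₀ →
        ¬ RedSiteRP 3 0 1 L P (G := Matrix.specialUnitaryGroup (Fin N) ℂ) (fundamentalRep (Fin N))
          Fin.zero_ne_one β := by
  haveI : SecondCountableTopology (Matrix (Fin N) (Fin N) ℂ) :=
    inferInstanceAs (SecondCountableTopology (Fin N → Fin N → ℂ))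
  haveI : SecondCountableTopology (Matrix.specialUnitaryGroup (Fin N) ℂ) :=
    Topology.IsEmbedding.subtypeVal.secondCountableTopology
  exact not_redSiteRP_uniform_specialUnitary (fundamentalRep (Fin N)) q12 Fin.zero_ne_one
    (by decide) (by decide)
    (Literature.MathematicalPhysics.QuantumFieldTheory.TorusAreaLaw.isSpecialUnitaryModel_fundamentalRep N) hN

/-- ★★★ **`U(N)` lattice gauge theory (`N ≥ 1`) on the boxes `ℤ³/Γ(2P, 2P, L)`: one `β₀ = β₀(N) > 0`
for every `P ≥ 2`, `L ≥ 2`.** [folklore] -/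
theorem not_redSiteRP_uniform_uN (hN : 1 ≤ N) :
    ∃ β₀ : ℝ, 0 < β₀ ∧ ∀ (P L : ℕ) [NeZero P] [NeZero L], 2 ≤ P → 2 ≤ L →
      ∀ β : ℝ, 0 < β → β ≤ β₀ →
        ¬ RedSiteRP 3 0 1 L P (G := Matrix.unitaryGroup (Fin N) ℂ) (unitaryFundamentalRep (Fin N) ℂ)
          Fin.zero_ne_one β := by
  haveI : SecondCountableTopology (Matrix (Fin N) (Fin N) ℂ) :=
    inferInstanceAs (SecondCountableTopology (Fin N → Fin N → ℂ))
  haveI : SecondCountableTopology (Matrix.unitaryGroup (Fin N) ℂ) :=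
    Topology.IsEmbedding.subtypeVal.secondCountableTopology
  exact not_redSiteRP_uniform_unitary (unitaryFundamentalRep (Fin N) ℂ) q12 Fin.zero_ne_one
    (by decide) (by decide)
    (Literature.MathematicalPhysics.QuantumFieldTheory.isUnitaryModel_unitaryFundamentalRep N) hN

/-- ★★ **No eventual transfer (`SU(N)`, `N ≥ 2`, `d = 3`).** For every `0 < β ≤ β₀(N)` reduced-half
site RP is not EVENTUALLY available along the even square tilted boxes `ℤ³/Γ(2P, 2P, L)` — for no
thresholds `P₀, L₀` does it hold for all `P ≥ P₀`, `L ≥ L₀`. So the finite-volume route by which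
in-plane site RP passes to the tilted LIMIT points in `d = 2` (`TiltedBoxLimitClassBTwoDimAll`) is
closed at small coupling in `d = 3`; the limit statement itself is not decided here. [folklore] -/
theorem not_eventually_redSiteRP_suN (hN : 2 ≤ N) :
    ∃ β₀ : ℝ, 0 < β₀ ∧ ∀ β : ℝ, 0 < β → β ≤ β₀ →
      ¬ ∃ P₀ L₀ : ℕ, ∀ (P L : ℕ) [NeZero P] [NeZero L], P₀ ≤ P → L₀ ≤ L →
        RedSiteRP 3 0 1 L P (G := Matrix.specialUnitaryGroup (Fin N) ℂ) (fundamentalRep (Fin N))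
          Fin.zero_ne_one β := by
  obtain ⟨β₀, hβ₀, h⟩ := not_redSiteRP_uniform_suN hN
  refine ⟨β₀, hβ₀, fun β hβ hβ1 => ?_⟩
  rintro ⟨P₀, L₀, hev⟩
  haveI : NeZero (P₀ + 2) := ⟨by omega⟩
  haveI : NeZero (L₀ + 2) := ⟨by omega⟩
  exact h (P₀ + 2) (L₀ + 2) (by omega) (by omega) β hβ hβ1 (hev (P₀ + 2) (L₀ + 2) (by omega) (by omega))

/-- ★★ **No eventual transfer (`U(N)`, `N ≥ 1`, `d = 3`).** [folklore] -/
theorem not_eventually_redSiteRP_uN (hN : 1 ≤ N) :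
    ∃ β₀ : ℝ, 0 < β₀ ∧ ∀ β : ℝ, 0 < β → β ≤ β₀ →
      ¬ ∃ P₀ L₀ : ℕ, ∀ (P L : ℕ) [NeZero P] [NeZero L], P₀ ≤ P → L₀ ≤ L →
        RedSiteRP 3 0 1 L P (G := Matrix.unitaryGroup (Fin N) ℂ) (unitaryFundamentalRep (Fin N) ℂ)
          Fin.zero_ne_one β := by
  obtain ⟨β₀, hβ₀, h⟩ := not_redSiteRP_uniform_uN hN
  refine ⟨β₀, hβ₀, fun β hβ hβ1 => ?_⟩
  rintro ⟨P₀, L₀, hev⟩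
  haveI : NeZero (P₀ + 2) := ⟨by omega⟩
  haveI : NeZero (L₀ + 2) := ⟨by omega⟩
  exact h (P₀ + 2) (L₀ + 2) (by omega) (by omega) β hβ hβ1 (hev (P₀ + 2) (L₀ + 2) (by omega) (by omega))

end Concrete

end RedSite

namespace RedLink

/-! ## Concrete, odd/link class: `SU(N)` and `U(N)` on the three-dimensional boxes; no eventual transfer -/

section Concrete

open Literature.MathematicalPhysics.QuantumLattice

variable {N : ℕ}

/-- ★★★ **`SU(N)` lattice Yang–Mills (`N ≥ 2`) on the odd square tilted boxes `ℤ³/Γ(2P+1, 2P+1, L)`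
(tilted plane `(0, 1)`): ONE `β₀ = β₀(N) > 0` such that reduced-half link RP along the axis `0`
fails on EVERY box `P ≥ 2`, `L ≥ 2` for all `0 < β ≤ β₀`** — although it holds at every `β` in two
dimensions. [folklore] -/
theorem not_redLinkRP_uniform_suN (hN : 2 ≤ N) :
    ∃ β₀ : ℝ, 0 < β₀ ∧ ∀ (P L : ℕ) [NeZero P] [NeZero L], 2 ≤ P → 2 ≤ L →
      ∀ β : ℝ, 0 < β → β ≤ β₀ →
        ¬ RedLinkRP 3 0 1 L P (G := Matrix.specialUnitaryGroup (Fin N) ℂ) (fundamentalRep (Fin N))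
          Fin.zero_ne_one β := by
  haveI : SecondCountableTopology (Matrix (Fin N) (Fin N) ℂ) :=
    inferInstanceAs (SecondCountableTopology (Fin N → Fin N → ℂ))
  haveI : SecondCountableTopology (Matrix.specialUnitaryGroup (Fin N) ℂ) :=
    Topology.IsEmbedding.subtypeVal.secondCountableTopology
  exact not_redLinkRP_uniform_specialUnitary (fundamentalRep (Fin N)) RedSite.q12 Fin.zero_ne_one
    (by decide) (by decide)
    (Literature.MathematicalPhysics.QuantumFieldTheory.TorusAreaLaw.isSpecialUnitaryModel_fundamentalRep N) hN

/-- ★★★ **`U(N)` lattice gauge theory (`N ≥ 1`) on the boxes `ℤ³/Γ(2P+1, 2P+1, L)`: one `β₀ = β₀(N) > 0`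
for every `P ≥ 2`, `L ≥ 2`.** [folklore] -/
theorem not_redLinkRP_uniform_uN (hN : 1 ≤ N) :
    ∃ β₀ : ℝ, 0 < β₀ ∧ ∀ (P L : ℕ) [NeZero P] [NeZero L], 2 ≤ P → 2 ≤ L →
      ∀ β : ℝ, 0 < β → β ≤ β₀ →
        ¬ RedLinkRP 3 0 1 L P (G := Matrix.unitaryGroup (Fin N) ℂ) (unitaryFundamentalRep (Fin N) ℂ)
          Fin.zero_ne_one β := by
  haveI : SecondCountableTopology (Matrix (Fin N) (Fin N) ℂ) :=
    inferInstanceAs (SecondCountableTopology (Fin N → Fin N → ℂ))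
  haveI : SecondCountableTopology (Matrix.unitaryGroup (Fin N) ℂ) :=
    Topology.IsEmbedding.subtypeVal.secondCountableTopology
  exact not_redLinkRP_uniform_unitary (unitaryFundamentalRep (Fin N) ℂ) RedSite.q12 Fin.zero_ne_one
    (by decide) (by decide)
    (Literature.MathematicalPhysics.QuantumFieldTheory.isUnitaryModel_unitaryFundamentalRep N) hN

/-- ★★ **No eventual transfer (`SU(N)`, `N ≥ 2`, `d = 3`).** For every `0 < β ≤ β₀(N)` reduced-half
link RP is not EVENTUALLY available along the odd square tilted boxes `ℤ³/Γ(2P+1, 2P+1, L)` — for no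
thresholds `P₀, L₀` does it hold for all `P ≥ P₀`, `L ≥ L₀`. So the finite-volume route by which
in-plane link RP passes to the tilted LIMIT points in `d = 2` (`TiltedBoxLimitClassBTwoDim`) is
closed at small coupling in `d = 3`; the limit statement itself is not decided here. [folklore] -/
theorem not_eventually_redLinkRP_suN (hN : 2 ≤ N) :
    ∃ β₀ : ℝ, 0 < β₀ ∧ ∀ β : ℝ, 0 < β → β ≤ β₀ →
      ¬ ∃ P₀ L₀ : ℕ, ∀ (P L : ℕ) [NeZero P] [NeZero L], P₀ ≤ P → L₀ ≤ L →
        RedLinkRP 3 0 1 L P (G := Matrix.specialUnitaryGroup (Fin N) ℂ) (fundamentalRep (Fin N))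
          Fin.zero_ne_one β := by
  obtain ⟨β₀, hβ₀, h⟩ := not_redLinkRP_uniform_suN hN
  refine ⟨β₀, hβ₀, fun β hβ hβ1 => ?_⟩
  rintro ⟨P₀, L₀, hev⟩
  haveI : NeZero (P₀ + 2) := ⟨by omega⟩
  haveI : NeZero (L₀ + 2) := ⟨by omega⟩
  exact h (P₀ + 2) (L₀ + 2) (by omega) (by omega) β hβ hβ1 (hev (P₀ + 2) (L₀ + 2) (by omega) (by omega))

/-- ★★ **No eventual transfer (`U(N)`, `N ≥ 1`, `d = 3`).** [folklore] -/
theorem not_eventually_redLinkRP_uN (hN : 1 ≤ N) :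
    ∃ β₀ : ℝ, 0 < β₀ ∧ ∀ β : ℝ, 0 < β → β ≤ β₀ →
      ¬ ∃ P₀ L₀ : ℕ, ∀ (P L : ℕ) [NeZero P] [NeZero L], P₀ ≤ P → L₀ ≤ L →
        RedLinkRP 3 0 1 L P (G := Matrix.unitaryGroup (Fin N) ℂ) (unitaryFundamentalRep (Fin N) ℂ)
          Fin.zero_ne_one β := by
  obtain ⟨β₀, hβ₀, h⟩ := not_redLinkRP_uniform_uN hN
  refine ⟨β₀, hβ₀, fun β hβ hβ1 => ?_⟩
  rintro ⟨P₀, L₀, hev⟩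
  haveI : NeZero (P₀ + 2) := ⟨by omega⟩
  haveI : NeZero (L₀ + 2) := ⟨by omega⟩
  exact h (P₀ + 2) (L₀ + 2) (by omega) (by omega) β hβ hβ1 (hev (P₀ + 2) (L₀ + 2) (by omega) (by omega))

end Concrete

end RedLink

/-! ## Summary row: the reduced-half classes for `SU(N)`, uniform version -/

section Summary

open Literature.MathematicalPhysics.QuantumLattice

variable {d : ℕ} {i j : Fin d} {N : ℕ}

/-- **`SU(N)` lattice Yang–Mills (`N ≥ 2`), the two REDUCED-half in-plane mirror classes of the
square tilted boxes of the plane `(i, j)`, with ONE window**: in `d = 2` (the two axes exhaust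
`Fin d`) reduced-half site RP on the even box and reduced-half link RP on the odd box HOLD on every
box (`P ≥ 2`) at every real `β`; with a transverse axis `k ∉ {i, j}` (`d ≥ 3`) there is ONE
`β₀ = β₀(d, N) > 0` such that BOTH FAIL on every box `P ≥ 2`, `L ≥ 2` for all `0 < β ≤ β₀`
(gen 51's rows `inPlaneMirrors_reducedSite_suN` / `inPlaneMirrors_reducedLink_suN` had a
box-dependent `β₀`). [folklore] -/
theorem inPlaneMirrors_reduced_uniform_suN (hij : i ≠ j) (hN : 2 ≤ N) :
    ((∀ k : Fin d, k = i ∨ k = j) → ∀ (P L : ℕ) [NeZero P] [NeZero L], 2 ≤ P → ∀ β : ℝ,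
      RedSite.RedSiteRP d i j L P (G := Matrix.specialUnitaryGroup (Fin N) ℂ) (fundamentalRep (Fin N)) hij β ∧
        RedLink.RedLinkRP d i j L P (G := Matrix.specialUnitaryGroup (Fin N) ℂ) (fundamentalRep (Fin N)) hij β) ∧
    (∀ k : Fin d, k ≠ i → k ≠ j →
      ∃ β₀ : ℝ, 0 < β₀ ∧ ∀ (P L : ℕ) [NeZero P] [NeZero L], 2 ≤ P → 2 ≤ L →
        ∀ β : ℝ, 0 < β → β ≤ β₀ →
          ¬ RedSite.RedSiteRP d i j L P (G := Matrix.specialUnitaryGroup (Fin N) ℂ) (fundamentalRep (Fin N)) hij β ∧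
            ¬ RedLink.RedLinkRP d i j L P (G := Matrix.specialUnitaryGroup (Fin N) ℂ) (fundamentalRep (Fin N)) hij β) := by
  haveI : SecondCountableTopology (Matrix (Fin N) (Fin N) ℂ) :=
    inferInstanceAs (SecondCountableTopology (Fin N → Fin N → ℂ))
  haveI : SecondCountableTopology (Matrix.specialUnitaryGroup (Fin N) ℂ) :=
    Topology.IsEmbedding.subtypeVal.secondCountableTopology
  have hρ := Literature.MathematicalPhysics.QuantumFieldTheory.TorusAreaLaw.isSpecialUnitaryModel_fundamentalRep N
  refine ⟨fun hd P L _ _ hP β => ⟨TwoDim.redSiteRP_twoDim (fundamentalRep (Fin N)) hP hij hd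
      (continuous_fundamentalRep (Fin N)) β,
    TwoDim.redLinkRP_twoDim (fundamentalRep (Fin N)) hij hd (continuous_fundamentalRep (Fin N)) β⟩,
    fun k hki hkj => ?_⟩
  obtain ⟨β₁, hβ₁, h₁⟩ := RedSite.not_redSiteRP_uniform_specialUnitary_of_axis (fundamentalRep (Fin N))
    hij hki hkj hρ hN
  obtain ⟨β₂, hβ₂, h₂⟩ := RedLink.not_redLinkRP_uniform_specialUnitary_of_axis (fundamentalRep (Fin N))
    hij hki hkj hρ hN
  refine ⟨min β₁ β₂, lt_min hβ₁ hβ₂, fun P L _ _ hP hL β hβ hβ0 => ⟨?_, ?_⟩⟩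
  · exact h₁ P L hP hL β hβ (hβ0.trans (min_le_left _ _))
  · exact h₂ P L hP hL β hβ (hβ0.trans (min_le_right _ _))

end Summary

end TiltedRP

end Summit.QuantumFields.GaugeBoot

end
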